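import Summits.Ventures.LatticeQCDFlow.Scaling.TaggedDeficitStarCoverBetween

/-!
HONEST FRAMING: exact (Metropolis-corrected) sampling algorithms for lattice gauge theory; figures
of merit are autocorrelation/cost numbers at stated couplings and volumes; no continuum-physics
claim.

# TaggedDeficitStarCoverEveryEdge — THE DISCOUNTED WEAK Σ ON EVERY EDGE: `D_J ≤ (K/(K²−1))·x̃(★)` FOR THE TAGGED CHAINS OF EVERY ADJACENT PAIR FROM EVERY ORDINARY
# HUB, EVERY `K ≥ 2` (lean-2 GEN-43, ours)

Venture-side (OURS).  Cell `lqcd-flow` (pub-lqcd), unit `pub-lqcd-lean-2-g43`, 2026-08-31.  Chapter AC, file 13 — files 11 and 12 assembled by the dispatch of chapter AB file 13: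
hub at or above `W_a` (file 11); below `W_a` with a third particle at or above `W_z`: `W_z ≤ W_b` deep (file 11) or `W_b < W_z` between (file 12); alone with every other present
content strictly below: `W_z ≤ W_b` residual (file 11) or `W_b < W_z` lone between (file 12).

* **`tagged_deficit_le_star_everyEdge`**: `Σ_{n<J}(1−σ)σⁿ(y_{n+1}(z) − x_{n+1}(z))⁺ ≤ (K/(K²−1))·x̃(★)` — hypotheses: the tagged chains of an adjacent pair (`W_b ≤ W_a`, any contents
  between), `N_C(z) ≠ 0`, `K ≥ 2`, `0 ≤ σ < 1`, the tail resolvent `x̃` of `X` from `z`; nothing else.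

With Conjecture W′ (file 3) this is the pair of per-edge inputs that the per-attempt bracket (file 10) and the mean condition of files 4–6 consume (memo MEMO-gen43 §3 (f)(i):
`c = 2K + 2 + m` with `m(1 − κ) ≥ κ`, `κ = K/(K²−1) ≤ 2/3`, so `m = 2`).  Literature grade (cell rule): OWN; nothing cited; no new bib keys.
-/

open Finset

namespace Summit.Ventures.LatticeQCDFlow.Scaling

section CoverEveryEdge
variable {S : Type*} [Fintype S] [DecidableEq S]
variable {W : S → ℝ} {acc : S → S → ℝ} {K : ℕ} {NC : S → ℕ} {a b : S} {PX PY : Option S → Option S → ℝ}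

/-- **`D_J ≤ (K/(K²−1))·x̃(★)` ON EVERY ADJACENT EDGE FROM EVERY ORDINARY HUB, EVERY `K ≥ 2`** (see the module docstring). [ours] -/
theorem tagged_deficit_le_star_everyEdge (hW : ∀ v, 0 < W v) (hacc : ∀ h v, acc h v = min 1 (W h / W v)) (hK : 2 ≤ K) (hNC : ∑ v, NC v = K) (hab : W b ≤ W a)
    (hPXoff : ∀ h v, h ≠ v → PX (some h) (some v) = if NC h = 0 then 0 else (NC v : ℝ) / K * acc h v)
    (hPXin : ∀ h, PX (some h) none = if NC h = 0 then 0 else acc h a / K)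
    (hPXdiag : ∀ h, PX (some h) (some h) = 1 - (∑ v ∈ univ.erase h, PX (some h) (some v) + PX (some h) none))
    (hPXout : ∀ v, PX none (some v) = (NC v : ℝ) / K * acc a v) (hPXstay : PX none none = 1 - ∑ v, PX none (some v))
    (hPYoff : ∀ h v, h ≠ v → PY (some h) (some v) = if NC h = 0 then 0 else (NC v : ℝ) / K * acc h v)
    (hPYin : ∀ h, PY (some h) none = if NC h = 0 then 0 else acc h b / K)
    (hPYdiag : ∀ h, PY (some h) (some h) = 1 - (∑ v ∈ univ.erase h, PY (some h) (some v) + PY (some h) none))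
    (hPYout : ∀ v, PY none (some v) = (NC v : ℝ) / K * acc b v) (hPYstay : PY none none = 1 - ∑ v, PY none (some v))
    {z : S} (hz : NC z ≠ 0)
    {x y : ℕ → Option S → ℝ}
    (hx0 : ∀ v, x 0 v = if v = some z then 1 else 0) (hxs : ∀ n v, x (n + 1) v = ∑ h, x n h * PX h v)
    (hy0 : ∀ v, y 0 v = if v = some z then 1 else 0) (hys : ∀ n v, y (n + 1) v = ∑ h, y n h * PY h v)
    {σ : ℝ} (hσ0 : 0 ≤ σ) (hσ1 : σ < 1) {xt : Option S → ℝ} (hxt : ∀ t, xt t = (1 - σ) * PX (some z) t + σ * ∑ t', xt t' * PX t' t) (J : ℕ) :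
    ∑ n ∈ range J, (1 - σ) * σ ^ n * max 0 (y (n + 1) (some z) - x (n + 1) (some z)) ≤ (K : ℝ) / ((K : ℝ) ^ 2 - 1) * xt none := by
  by_cases haz : W a ≤ W z
  · exact tagged_deficit_le_star_above hW hacc hK hNC hab hPXoff hPXin hPXdiag hPXout hPXstay hPYoff hPYin hPYdiag hPYout hPYstay
      hz haz hx0 hxs hy0 hys hσ0 hσ1 hxt J
  · have hza : W z < W a := lt_of_not_ge haz
    by_cases hthree : 2 ≤ NC z ∨ ∃ w, w ≠ z ∧ NC w ≠ 0 ∧ W z ≤ W w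
    · by_cases hzb : W z ≤ W b
      · exact tagged_deficit_le_star_deep hW hacc hK hNC hab hPXoff hPXin hPXdiag hPXout hPXstay hPYoff hPYin hPYdiag hPYout hPYstay
          hz hzb hza hthree hx0 hxs hy0 hys hσ0 hσ1 hxt J
      · exact tagged_deficit_le_star_between hW hacc hK hNC hPXoff hPXin hPXdiag hPXout hPXstay hPYoff hPYin hPYdiag hPYout hPYstay
          hz (le_of_lt (lt_of_not_ge hzb)) hza hthree hx0 hxs hy0 hys hσ0 hσ1 hxt J
    · have hz2 : ¬ 2 ≤ NC z := fun h => hthree (Or.inl h)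
      have hz1 : NC z = 1 := by omega
      have hbelow : ∀ w, w ≠ z → NC w ≠ 0 → W w < W z := fun w hwz hNw =>
        lt_of_not_ge fun hle => hthree (Or.inr ⟨w, hwz, hNw, hle⟩)
      by_cases hzb : W z ≤ W b
      · exact tagged_deficit_le_star_residual hW hacc hK hNC hab hPXoff hPXin hPXdiag hPXout hPXstay hPYoff hPYin hPYdiag hPYout hPYstay
          hz1 hzb hza hbelow hx0 hxs hy0 hys hσ0 hσ1 hxt J
      · exact tagged_deficit_le_star_loneBetween hW hacc hK hNC hPXoff hPXin hPXdiag hPXout hPXstay hPYoff hPYin hPYdiag hPYout hPYstay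
          hz1 (le_of_lt (lt_of_not_ge hzb)) hza hbelow hx0 hxs hy0 hys hσ0 hσ1 hxt J

end CoverEveryEdge

end Summit.Ventures.LatticeQCDFlow.Scaling
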